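import Summits.BirchSwinnertonDyer.BirchSwinnertonDyer.Theorems.AlignedTransportAtTwoBSDOfMainConjectureRankOneAtTwoEulerCharAtTwoKerGIndex
import Summits.BirchSwinnertonDyer.BirchSwinnertonDyer.Theorems.AlignedTransportAtTwoBSDOfMainConjectureRankOneAtTwoEulerCharAtTwoAssemblyKummer
import Literature.NumberTheory.EllipticCurves.ArchimedeanKummerImageMaximal
import Literature.NumberTheory.GaloisRepresentations.ContinuousH1OrderTwo
import HarnessLib

/-!
# Route `AlignedTransportAtTwo`, crux C3′ `BSDOfMainConjectureRankOneAtTwo` (stmt-BirchSwinnertonDyer-23008), line `birth`,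
# the (L) road of the kernel index: the two `Ш`-EXPONENT bookkeeping hypotheses of the (L) identity DISCHARGED from
# `#Ш(E/K)[p^∞] < ∞`

HONEST FRAMING (cell `bsd-f1-sign2`, attach seat `bsd-line-att-p3` g12 under the C3′ lead lineage `bsd-line-att-p1`;
`--supports stmt-BirchSwinnertonDyer-23008 --as helper`). BSD is NOT proved; C3′ is NOT closed; nothing is asserted. THEOREMS
ONLY (no `def`, no named fact, no `sorry`). Successor of `…EulerCharAtTwoKerGIndex` (att-p3 g11), whose (L) identity
`#(A₀/Sel₀) · [E(K) : E_𝒦] = ∏_{v∈S} #𝒦_{v,0}[p^∞]` carried two level-`p^k` hypotheses — (Ш-exp) «a class of `H¹(K, E[p^k])` that is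
Kummer at every FINITE place has `p^e • c ∈ κ_{p^k}(E(K))`» and (div) «`p^e Sel₀ ⊆ p^{n+e} Sel₀`» — here derived from ONE exponent
`p^{e₁}` of `Ш(E/K)[p^∞]`, hence from its finiteness.

* §1 `pow_succ_nsmul_mem_range_kummerMapTorsion_of_forall_finite` — (Ш-exp) with `e = e₁ + 1`: if `p^{e₁}` kills
  `Ш(E/K) ∩ H¹(K,E)[p^k]` then every `c ∈ H¹(K, E[p^k])` Kummer at all finite places has `p^{e₁+1} • c ∈ κ_{p^k}(E(K))`. The one
  extra factor `p` is the ARCHIMEDEAN RELAXATION: `p • H¹(K_w, E[p^k]) = 0` at every infinite place `w` (`p = 2`: Serre I §2.4,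
  tree `two_nsmul_galoisCohomology_one_toLocal_inl_eq_zero`; `p` odd: `H¹(K_w, E[p^k]) = 0`, tree
  `galoisCohomology_one_torsion_eq_zero_infinitePlace_of_odd`), so `p • c ∈ Sel^{(p^k)}(E/K)`, and X11b's
  `KummerDecomp.nsmul_mem_range_kummerMapTorsion_of_mem_selmerGroup` finishes.
* §2 `exists_mem_selmerLayer_pow_nsmul_eq` — (div): if `p^{e₁}` kills `Ш(E/K)[p^∞]` then for every `s ∈ Sel₀` and every `m`,
  `p^{e₁} • s = p^{m+e₁} • d` with `d ∈ Sel₀`: transport along `Sel_{p^∞}(E/K) ≃+ Sel₀` (att-p4 `exists_selmerLayerZero_addEquiv`),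
  `p^{e₁} • c` dies in `Ш`, so lies in the image of the `p^∞` Kummer map (`range_kummerMapPInfty`, `map_primaryH1ToH1_selmerGroupPInfty`),
  whose source `E(K) ⊗ ℚ_p/ℤ_p` is `p`-divisible (`tensorPrufer_divisible`).
* §3 `exists_pointObstructionHom_natCard_kerG_zero_mul_eq_prod_of_shaExponent` — THE (L) IDENTITY of `…KerGIndex` with the two
  hypotheses replaced by «`p^{e₁}` kills `Ш(E/K)[p^∞]`» at any level `k = n + 2 + e₁`; and
  `exists_forall_pow_nsmul_eq_zero_of_finite_sha` — a finite `Ш(E/K)[p^∞]` has such an exponent.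

What this does NOT do: evaluate the local orders (Greenberg Lemmas 3.3/3.4, PRINT), or touch (H) (height = Bockstein; research).

References: [GreenbergLNM1716] §4 p. 104, Lemma 4.7 (pp. 107–108), Prop. 4.13 (pp. 120–123); [MilneADT2006] I Rem. 3.7, Lemma 6.15;
[SerreGaloisCohomology1997] I §2.4; [SilvermanAEC2009] X.4.2.
bears_on: stmt-BirchSwinnertonDyer-23008 (helper; closes nothing), stmt-BirchSwinnertonDyer-22298 (attach seat's item; untouched).
-/

set_option autoImplicit false
-- the Theorems namespace of this sub repeats the summit name by design (D-0017 nested layout)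
set_option linter.dupNamespace false

noncomputable section

open scoped Classical NumberField

open CategoryTheory Field NumberField IsDedekindDomain Function WeierstrassCurve
open Literature.NumberTheory.EllipticCurves Literature.NumberTheory.EllipticCurves.GreenbergSelmer
open Literature.NumberTheory.GaloisRepresentations
open Literature.NumberTheory.GaloisRepresentations.DiscreteGaloisModule (SelmerStructure unramifiedSubgroup mu MuCarrier)
open Literature.NumberTheory.GaloisCohomology
open scoped ContRepresentation TensorProduct

namespace Summit.BirchSwinnertonDyer.BirchSwinnertonDyer.Theorems.AlignedTransportAtTwoEulerCharAtTwoKerGShaExponent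

open Summit.BirchSwinnertonDyer.Rank1Residual.X11b Summit.BirchSwinnertonDyer.Rank1Residual.X11b.KummerPT
open Summit.BirchSwinnertonDyer.Rank1Residual.X11b.LocBridge
open Summit.BirchSwinnertonDyer.Rank1Residual.X11b.Levels
open Summit.BirchSwinnertonDyer.Rank1Residual.X11b.AcSelmer
open Summit.BirchSwinnertonDyer.Rank1Residual.X11b.Relaxation
open Summit.BirchSwinnertonDyer.Rank1Residual.X11b.KummerDecomp
open Summit.BirchSwinnertonDyer.BirchSwinnertonDyer.Theorems.SignedEC.CasselsPT
open Summit.BirchSwinnertonDyer.BirchSwinnertonDyer.Theorems.AlignedTransportAtTwoEulerCharAtTwoKerGCassels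
open Summit.BirchSwinnertonDyer.BirchSwinnertonDyer.Theorems.AlignedTransportAtTwoEulerCharAtTwoKerGImage
open Summit.BirchSwinnertonDyer.BirchSwinnertonDyer.Theorems.AlignedTransportAtTwoEulerCharAtTwoKerGObstruction
open Summit.BirchSwinnertonDyer.BirchSwinnertonDyer.Theorems.AlignedTransportAtTwoEulerCharAtTwoKerGCount
open Summit.BirchSwinnertonDyer.BirchSwinnertonDyer.Theorems.AlignedTransportAtTwoEulerCharAtTwoKerGIndex
open Summit.BirchSwinnertonDyer.BirchSwinnertonDyer.Theorems.AlignedTransportAtTwoEulerCharAtTwoAssemblyKummer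
open ZpExtension Literature.NumberTheory.EllipticCurves.GreenbergVatsal2000 Summit.BirchSwinnertonDyer.Rank1Residual.X2

/-! ## §1 The archimedean relaxation and the Ш-exponent at a finite level -/

section ShaExp

variable {K : Type} [Field K] [NumberField K] (W : WeierstrassCurve K) [W.IsElliptic] (p : ℕ) [hp : Fact p.Prime]
  (k : ℕ)

omit [W.IsElliptic] in
/-- **ARCHIMEDEAN RELAXATION: `p • H¹(K_w, E[p^k]) = 0` at an infinite place `w`.** For `p = 2` this is `2 • H¹(ℝ, ·) = 0`
(Serre I §2.4); for odd `p` the group itself vanishes. [cite: SerreGaloisCohomology1997, I §2.4] [cite: MilneADT2006, Ch. I, Rem. 3.7] -/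
theorem prime_nsmul_localization_inl_eq_zero (w : InfinitePlace K)
    (c : galoisCohomology (W.torsionGaloisModule ((p ^ k : ℕ) : ℤ)) 1) :
    p • galoisCohomology.localization (W.torsionGaloisModule ((p ^ k : ℕ) : ℤ)) (Sum.inl w) 1 c = 0 := by
  rcases (Fact.out : p.Prime).eq_two_or_odd' with rfl | hodd
  · exact two_nsmul_galoisCohomology_one_toLocal_inl_eq_zero _ w _
  · have h0 : galoisCohomology.localization (W.torsionGaloisModule ((p ^ k : ℕ) : ℤ)) (Sum.inl w) 1 c = 0 :=
      galoisCohomology_one_torsion_eq_zero_infinitePlace_of_odd W w (by exact_mod_cast hodd.pow) _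
    rw [h0, smul_zero]

omit [W.IsElliptic] in
/-- **A class Kummer at every FINITE place becomes Selmer after multiplication by `p`** (archimedean relaxation).
[cite: MilneADT2006, Ch. I, Rem. 3.7 and Lemma 6.15] [cite: SilvermanAEC2009, X.§4] -/
theorem prime_nsmul_mem_selmerGroup_of_forall_finite
    (c : galoisCohomology (W.torsionGaloisModule ((p ^ k : ℕ) : ℤ)) 1)
    (hc : ∀ v : HeightOneSpectrum (𝓞 K),
      galoisCohomology.localization (W.torsionGaloisModule ((p ^ k : ℕ) : ℤ)) (Sum.inr v) 1 c ∈
        W.kummerSelmerStructure ((p ^ k : ℕ) : ℤ) (Sum.inr v)) :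
    (p • c : galH1Torsion W ((p ^ k : ℕ) : ℤ)) ∈ selmerGroup W ((p ^ k : ℕ) : ℤ) := by
  refine (W.mem_selmerGroup_iff_forall_localization_mem _ _).mpr ?_
  rintro (w | v)
  · rw [map_nsmul, prime_nsmul_localization_inl_eq_zero W p k w c]
    exact AddSubgroup.zero_mem _
  · rw [map_nsmul]
    exact AddSubgroup.nsmul_mem _ (hc v) p

/-- **(Ш-exp) FROM A Ш-EXPONENT.** If `p^{e₁}` kills `Ш(E/K) ∩ H¹(K, E)[p^k]`, then every `c ∈ H¹(K, E[p^k])` satisfying the Kummer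
condition at every finite place has **`p^{e₁+1} • c ∈ κ_{p^k}(E(K))`** (`p • c` is Selmer by the archimedean relaxation, and
`p^{e₁} • Sel^{(p^k)} ⊆ κ(E(K))` by X.4.2). This is hypothesis `hSha` of `…KerGCassels` / `…KerGIndex` with `e = e₁ + 1`.
[cite: SilvermanAEC2009, Thm X.4.2(a) and §VIII.2] [cite: MilneADT2006, Ch. I, Rem. 3.7] -/
theorem pow_succ_nsmul_mem_range_kummerMapTorsion_of_forall_finite (e₁ : ℕ)
    (hShaExp : ∀ z ∈ W.sha ⊓ AddSubgroup.torsionBy W.galH1 ((p ^ k : ℕ) : ℤ), p ^ e₁ • z = 0)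
    (c : galoisCohomology (W.torsionGaloisModule ((p ^ k : ℕ) : ℤ)) 1)
    (hc : ∀ v : HeightOneSpectrum (𝓞 K),
      galoisCohomology.localization (W.torsionGaloisModule ((p ^ k : ℕ) : ℤ)) (Sum.inr v) 1 c ∈
        W.kummerSelmerStructure ((p ^ k : ℕ) : ℤ) (Sum.inr v)) :
    p ^ (e₁ + 1) • c ∈ (kummerMapTorsion W ((p ^ k : ℕ) : ℤ)
      (W.zsmul_geomPoints_surjective_holds (natCast_pow_ne_zero p k))).range := by
  rw [pow_succ, mul_smul]
  exact nsmul_mem_range_kummerMapTorsion_of_mem_selmerGroup W (natCast_pow_ne_zero p k) (p ^ e₁) hShaExp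
    (prime_nsmul_mem_selmerGroup_of_forall_finite W p k c hc)

omit [W.IsElliptic] hp in
/-- A Ш-exponent on the `p`-primary part gives one on `Ш ∩ H¹(K,E)[p^k]`. [folklore] -/
theorem pow_nsmul_eq_zero_of_mem_sha_inf_torsionBy (e₁ : ℕ)
    (hShaExp : ∀ z : ↥W.sha, z ∈ AddCommGroup.primaryComponent (↥W.sha) p → p ^ e₁ • z = 0)
    {z : W.galH1} (hz : z ∈ W.sha ⊓ AddSubgroup.torsionBy W.galH1 ((p ^ k : ℕ) : ℤ)) : p ^ e₁ • z = 0 := by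
  have hmem : (⟨z, hz.1⟩ : ↥W.sha) ∈ AddCommGroup.primaryComponent (↥W.sha) p := by
    rw [AddCommGroup.mem_primaryComponent]
    refine ⟨k, Subtype.ext ?_⟩
    have h2 : ((p ^ k : ℕ) : ℤ) • z = 0 := hz.2
    rw [natCast_zsmul] at h2
    exact h2
  exact congrArg Subtype.val (hShaExp _ hmem)

end ShaExp

/-! ## §2 Divisibility on `Sel₀` from a Ш-exponent -/

section Div

variable {K : Type} [Field K] [NumberField K] (W : WeierstrassCurve K) [W.IsElliptic] (p : ℕ) [hp : Fact p.Prime]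
  (κ : ZpExtension K p)

/-- `G ⊗ ℚ_p/ℤ_p` is divisible by every power of `p`. [folklore] -/
theorem tensorPrufer_pow_divisible {G : Type*} [AddCommGroup G] (m : ℕ) (x : G ⊗[ℤ] PruferQuot p) :
    ∃ y : G ⊗[ℤ] PruferQuot p, p ^ m • y = x := by
  induction m generalizing x with
  | zero => exact ⟨x, by rw [pow_zero, one_smul]⟩
  | succ m ih =>
    obtain ⟨y, rfl⟩ := tensorPrufer_divisible p G x
    obtain ⟨z, rfl⟩ := ih y
    exact ⟨z, by rw [pow_succ, mul_comm, mul_smul]⟩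

/-- **(div) FROM A Ш-EXPONENT.** If `p^{e₁}` kills `Ш(E/K)[p^∞]` then for every `s ∈ Sel₀ = Sel_{p^∞}(E/K_0)` and every `m` there is
`d ∈ Sel₀` with **`p^{e₁} • s = p^{m+e₁} • d`**: along `Sel_{p^∞}(E/K) ≃+ Sel₀` the class `p^{e₁} • s` dies in `Ш`, so it is the
`p^∞` Kummer class of some `t ∈ E(K) ⊗ ℚ_p/ℤ_p = p^{m+e₁}(E(K) ⊗ ℚ_p/ℤ_p)`. This is hypothesis `hdiv` of `…KerGIndex`.
[cite: GreenbergLNM1716, §1 p. 54, §2 pp. 62–63] [cite: SilvermanAEC2009, Thm X.4.2(a)] -/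
theorem exists_mem_selmerLayer_pow_nsmul_eq (e₁ m : ℕ)
    (hShaExp : ∀ z : ↥W.sha, z ∈ AddCommGroup.primaryComponent (↥W.sha) p → p ^ e₁ • z = 0)
    {s : W.subgroupH1 p (κ.layerSubgroup 0)} (hs : s ∈ W.selmerLayer κ 0) :
    ∃ d ∈ W.selmerLayer κ 0, p ^ e₁ • s = p ^ (m + e₁) • d := by
  have hdiv : W.zsmul_geomPoints_surjective := W.zsmul_geomPoints_surjective_holds
  obtain ⟨e₀, -⟩ := exists_selmerLayerZero_addEquiv (p := p) W κ
  -- `s = e₀ c`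
  set c : ↥(W.selmerGroupPInfty p) := e₀.symm ⟨s, hs⟩ with hcdef
  have hsc : (⟨s, hs⟩ : ↥(W.selmerLayer κ 0)) = e₀ c := by rw [hcdef, AddEquiv.apply_symm_apply]
  -- the image of `c` in `H¹(K, E)` lies in `Ш[p^∞]`, hence is killed by `p^{e₁}`
  have himg : primaryH1ToH1 W p (c : W.galH1Primary p) ∈ (AddCommGroup.primaryComponent (↥W.sha) p).map W.sha.subtype := by
    rw [← map_primaryH1ToH1_selmerGroupPInfty W p hdiv]
    exact ⟨c, c.2, rfl⟩
  obtain ⟨z, hz, hzc⟩ := himg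
  have hker : p ^ e₁ • (c : W.galH1Primary p) ∈ (primaryH1ToH1 W p).ker := by
    rw [AddMonoidHom.mem_ker, map_nsmul, ← hzc]
    change p ^ e₁ • ((z : ↥W.sha) : W.galH1) = 0
    rw [← AddSubgroupClass.coe_nsmul, hShaExp z hz, AddSubgroup.coe_zero]
  -- so it is a `p^∞` Kummer class, of a `p^{m+e₁}`-divisible element
  rw [← range_kummerMapPInfty W p hdiv] at hker
  obtain ⟨t, ht⟩ := hker
  obtain ⟨t', rfl⟩ := tensorPrufer_pow_divisible p (m + e₁) t
  have hmem' : kummerMapPInfty W p hdiv t' ∈ W.selmerGroupPInfty p := by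
    apply ker_primaryH1ToH1_le_selmerGroupPInfty
    rw [← range_kummerMapPInfty W p hdiv]
    exact ⟨t', rfl⟩
  set c' : ↥(W.selmerGroupPInfty p) := ⟨kummerMapPInfty W p hdiv t', hmem'⟩ with hc'def
  have hcc' : p ^ e₁ • c = p ^ (m + e₁) • c' := by
    apply Subtype.ext
    change p ^ e₁ • (c : W.galH1Primary p) = p ^ (m + e₁) • kummerMapPInfty W p hdiv t'
    rw [← ht, map_nsmul]
  refine ⟨((e₀ c' : ↥(W.selmerLayer κ 0)) : W.subgroupH1 p (κ.layerSubgroup 0)), (e₀ c').2, ?_⟩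
  have h1 : e₀.toAddMonoidHom (p ^ e₁ • c) = p ^ e₁ • e₀.toAddMonoidHom c := map_nsmul _ _ _
  have h2 : e₀.toAddMonoidHom (p ^ (m + e₁) • c') = p ^ (m + e₁) • e₀.toAddMonoidHom c' := map_nsmul _ _ _
  have key : p ^ e₁ • (⟨s, hs⟩ : ↥(W.selmerLayer κ 0)) = p ^ (m + e₁) • e₀ c' := by
    rw [hsc]
    change p ^ e₁ • e₀.toAddMonoidHom c = p ^ (m + e₁) • e₀.toAddMonoidHom c'
    rw [← h1, ← h2, hcc']
  have h := congrArg (fun x : ↥(W.selmerLayer κ 0) ↦ (x : W.subgroupH1 p (κ.layerSubgroup 0))) key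
  simpa using h

end Div

/-! ## §3 The (L) identity from a Ш-exponent, and from the finiteness of `Ш(E/K)[p^∞]` -/

section Identity

variable {K : Type} [Field K] [NumberField K] (W : WeierstrassCurve K) [W.IsElliptic] (p : ℕ) [hp : Fact p.Prime]
  (κ : ZpExtension K p)

omit [W.IsElliptic] hp in
/-- **A finite `Ш(E/K)[p^∞]` has an exponent**: some `p^{e₁}` kills it. [folklore] -/
theorem exists_forall_pow_nsmul_eq_zero_of_finite_sha [Finite (AddCommGroup.primaryComponent (↥W.sha) p)] :
    ∃ e₁ : ℕ, ∀ z : ↥W.sha, z ∈ AddCommGroup.primaryComponent (↥W.sha) p → p ^ e₁ • z = 0 := by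
  classical
  haveI := Fintype.ofFinite (AddCommGroup.primaryComponent (↥W.sha) p)
  choose f hf using fun z : AddCommGroup.primaryComponent (↥W.sha) p ↦ AddCommGroup.mem_primaryComponent.mp z.2
  refine ⟨Finset.univ.sup f, fun z hz ↦ ?_⟩
  have hle : f ⟨z, hz⟩ ≤ Finset.univ.sup f := Finset.le_sup (Finset.mem_univ _)
  obtain ⟨r, hr⟩ := Nat.exists_eq_add_of_le hle
  rw [hr, pow_add, mul_comm, mul_smul]
  have h0 : p ^ f ⟨z, hz⟩ • z = 0 := hf ⟨z, hz⟩
  rw [h0, smul_zero]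

omit [W.IsElliptic] in
/-- **A uniform exponent for the finite local kernels on `S`**: some `p^n` kills `𝒦_{v,0}[p^∞]` for every `v ∈ S`. [folklore] -/
theorem exists_forall_pow_nsmul_localTowerKerPrimary_eq_zero (S : Finset (HeightOneSpectrum (𝓞 K)))
    (hfin : ∀ v ∈ S, Finite (W.localTowerKerPrimary κ (v.adicCompletion K) 0)) :
    ∃ n : ℕ, ∀ v ∈ S, ∀ x ∈ W.localTowerKerPrimary κ (v.adicCompletion K) 0, p ^ n • x = 0 := by
  classical
  have hv : ∀ v : HeightOneSpectrum (𝓞 K), ∃ n : ℕ, v ∈ S →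
      ∀ x ∈ W.localTowerKerPrimary κ (v.adicCompletion K) 0, p ^ n • x = 0 := by
    intro v
    by_cases hvS : v ∈ S
    · haveI : Finite (W.localTowerKerPrimary κ (v.adicCompletion K) 0) := hfin v hvS
      have hsfin : ((W.localTowerKerPrimary κ (v.adicCompletion K) 0 :
          AddSubgroup (discreteH1 (localSubgroup (κ.layerSubgroup 0) (v.adicCompletion K))
            (localPoints W (v.adicCompletion K)))) :
          Set (discreteH1 (localSubgroup (κ.layerSubgroup 0) (v.adicCompletion K))
            (localPoints W (v.adicCompletion K)))).Finite := Set.toFinite _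
      obtain ⟨N, hN⟩ := exists_pow_smul_eq_zero_of_finite (p := p) hsfin
        (fun x hx ↦ ((W.mem_localTowerKerPrimary_iff κ (v.adicCompletion K) 0 x).mp (SetLike.mem_coe.mp hx)).2)
      exact ⟨N, fun _ x hx ↦ hN x (SetLike.mem_coe.mpr hx)⟩
    · exact ⟨0, fun h ↦ absurd h hvS⟩
  choose nv hnv using hv
  refine ⟨S.sup nv, fun v hv x hx ↦ ?_⟩
  obtain ⟨r, hr⟩ := Nat.exists_eq_add_of_le (Finset.le_sup hv : nv v ≤ S.sup nv)
  rw [hr, pow_add, mul_comm, mul_smul, hnv v hv x hx, smul_zero]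

variable (k : ℕ)
  (ew : W.geomTorsion ((p ^ k : ℕ) : ℤ) → W.geomTorsion ((p ^ k : ℕ) : ℤ) → AlgebraicClosure K)
  (hμ : ∀ S T, ew S T ^ (p ^ k) = 1)
  (hadd₁ : ∀ S₁ S₂ T, ew (S₁ + S₂) T = ew S₁ T * ew S₂ T)
  (hadd₂ : ∀ S T₁ T₂, ew S (T₁ + T₂) = ew S T₁ * ew S T₂)
  (hgal : ∀ (σ : absoluteGaloisGroup K) (S T : W.geomTorsion ((p ^ k : ℕ) : ℤ)), σ • ew S T = ew (σ • S) (σ • T))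
  (halt : ∀ T, ew T T = 1) (hnondeg : ∀ T, (∀ S, ew S T = 1) → T = 0)

set_option maxHeartbeats 2000000 in -- instance-path unifications on the local cohomology groups (as in `…KerGIndex`)
include halt hnondeg in
/-- **THE (L) IDENTITY `#(A₀/Sel₀) · [E(K) : E_𝒦] = ∏_{v∈S} #𝒦_{v,0}[p^∞]` FROM A Ш-EXPONENT** (Greenberg LNM 1716 Lemma 4.7 /
Cassels–Poitou–Tate in POSITIVE rank): the statement of `…KerGIndex.exists_pointObstructionHom_natCard_kerG_zero_mul_eq_prod` — `K` a number
field, `κ` CYCLOTOMIC, `E(K̄)[p^∞]^{Γ_K} = 0`, `S` finite with good reduction and `v ∤ p` off `S`, `𝒦_{v,0}[p^∞]` finite and killed by `p^n`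
on `S`, a Poitou–Tate family `inv` at level `p^k` with `IsPerfect`, `SumLocalTermEqZero`, `SelmerComplement`, a Weil pairing on `E[p^k]` —
with its two Ш-exponent bookkeeping hypotheses REPLACED by «`p^{e₁}` kills `Ш(E/K)[p^∞]`» and the level taken as `k = n + 2 + e₁` (one
factor `p` for `Ш`'s exponent bookkeeping, one for the archimedean relaxation). Conclusion verbatim: a bi-additive
`B : ∏_{v∈S} 𝒦_{v,0}[p^∞] →+ (E(K) →+ ℤ/p^k)` computing the point obstruction on every family of Kummer lifts, `E(K)/E_𝒦` finite for
`E_𝒦 = ker B.flip`, and **`#(A₀/Sel₀) · #(E(K)/E_𝒦) = ∏_{v∈S} #𝒦_{v,0}[p^∞]`**.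
[cite: GreenbergLNM1716, §4 p. 104, Lemma 4.7 (pp. 107–108), Prop. 4.13 (pp. 120–123)] [cite: MilneADT2006, Ch. I, Rem. 3.7, Lemma 6.15,
Thm. 6.13] [cite: SilvermanAEC2009, Thm X.4.2(a)] -/
theorem exists_pointObstructionHom_natCard_kerG_zero_mul_eq_prod_of_shaExponent (hκ : κ.IsCyclotomic)
    (hE0 : Nat.card (MulAction.fixedPoints (absoluteGaloisGroup K) (W.geomPrimaryTorsion p)) = 1)
    (S : Finset (HeightOneSpectrum (𝓞 K)))
    (hS : ∀ v ∉ S, ((p : ℕ) : 𝓞 K) ∉ v.asIdeal ∧ W.HasGoodReductionAt v)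
    (hfin : ∀ v ∈ S, Finite (W.localTowerKerPrimary κ (v.adicCompletion K) 0))
    {n e₁ : ℕ} (hk : n + 2 + e₁ = k)
    (hXn : ∀ v ∈ S, ∀ x ∈ W.localTowerKerPrimary κ (v.adicCompletion K) 0, p ^ n • x = 0)
    {inv : LocalInvariants K (p ^ k)} (hperf : inv.IsPerfect) (hvan : inv.SumLocalTermEqZero)
    (hcompl : inv.SelmerComplement)
    (hShaExp : ∀ z : ↥W.sha, z ∈ AddCommGroup.primaryComponent (↥W.sha) p → p ^ e₁ • z = 0) :
    ∃ B : (∀ v : S, W.localTowerKerPrimary κ (v.1.adicCompletion K) 0) →+ (W.toAffine.Point →+ ZMod (p ^ k)),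
      (∀ (x : ∀ v : S, W.localTowerKerPrimary κ (v.1.adicCompletion K) 0)
        (t : Π v : Place K, galoisCohomology ((W.torsionGaloisModule ((p ^ k : ℕ) : ℤ)).toLocal v) 1),
        (∀ v : S,
          resH1Hom (Literature.NumberTheory.EllipticCurves.subgroupIncl
              (localSubgroup (⊤ : Subgroup (absoluteGaloisGroup K)) (v.1.adicCompletion K)))
            (AddMonoidHom.id (localPoints W (v.1.adicCompletion K))) (fun _ _ ↦ rfl)
            (galoisCohomology.map (W.torsionPointsMapIntertwining ((p ^ k : ℕ) : ℤ) (v.1.adicCompletion K)) 1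
              (t (Sum.inr v.1))) =
          Literature.NumberTheory.EllipticCurves.resOfLe (localPoints W (v.1.adicCompletion K))
            (localSubgroup_top_le_layerSubgroup_zero κ (v.1.adicCompletion K))
            ((x v : W.localTowerKerPrimary κ (v.1.adicCompletion K) 0) :
              discreteH1 (localSubgroup (κ.layerSubgroup 0) (v.1.adicCompletion K))
                (localPoints W (v.1.adicCompletion K)))) →
        ∀ P : W.toAffine.Point,
          B x P = ∑ u ∈ S, invWeilPairing W (p ^ k) ew hμ hadd₁ hadd₂ hgal inv (Sum.inr u) (t (Sum.inr u))
            (galoisCohomology.localization (W.torsionGaloisModule ((p ^ k : ℕ) : ℤ)) (Sum.inr u) 1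
              (kummerMapTorsion W ((p ^ k : ℕ) : ℤ)
                (W.zsmul_geomPoints_surjective_holds (natCast_pow_ne_zero p k)) P))) ∧
      Finite (W.toAffine.Point ⧸ B.flip.ker) ∧
      Nat.card (W.KerG κ 0) * Nat.card (W.toAffine.Point ⧸ B.flip.ker) =
        ∏ v ∈ S, Nat.card (W.localTowerKerPrimary κ (v.adicCompletion K) 0) :=
  exists_pointObstructionHom_natCard_kerG_zero_mul_eq_prod W p κ k ew hμ hadd₁ hadd₂ hgal halt hnondeg hκ hE0 S hS hfin
    (show n + 1 + (e₁ + 1) = k by omega) hXn hperf hvan hcompl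
    (fun c hc ↦ pow_succ_nsmul_mem_range_kummerMapTorsion_of_forall_finite W p k e₁
      (fun _ hz ↦ pow_nsmul_eq_zero_of_mem_sha_inf_torsionBy W p k e₁ hShaExp hz) c hc)
    (fun s hs ↦ by
      obtain ⟨d, hd, hde⟩ := exists_mem_selmerLayer_pow_nsmul_eq W p κ e₁ n hShaExp hs
      refine ⟨d, hd, ?_⟩
      calc p ^ (e₁ + 1) • s = p • (p ^ e₁ • s) := by rw [pow_succ', mul_smul]
        _ = p • (p ^ (n + e₁) • d) := by rw [hde]
        _ = p ^ (n + (e₁ + 1)) • d := by rw [← mul_smul, ← pow_succ', Nat.add_assoc])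

set_option maxHeartbeats 2000000 in -- as above
/-- **THE (L) IDENTITY AT EVERY SUFFICIENTLY DEEP LEVEL, FROM `#Ш(E/K)[p^∞] < ∞`.** `K` a number field, `p` a prime, `κ` the CYCLOTOMIC
`ℤ_p`-extension, `E(K̄)[p^∞]^{Γ_K} = 0`, `S` a finite set of finite places off which `E` has good reduction and `v ∤ p`, the local kernels
`𝒦_{v,0}[p^∞]` finite on `S`, and `Ш(E/K)[p^∞]` FINITE. Then there is a level `k₀` such that at EVERY level `k ≥ k₀`, for every Weil pairing
`ew` on `E[p^k]` (alternating, non-degenerate, Galois-equivariant — `W.exists_weilPairing_holds`) and every Poitou–Tate family `inv` at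
level `p^k` with `IsPerfect`, `SumLocalTermEqZero`, `SelmerComplement` (tree THEOREM `poitouTate_selmerStructure_duality_holds`), there
is a bi-additive `B : ∏_{v∈S} 𝒦_{v,0}[p^∞] →+ (E(K) →+ ℤ/p^k)` computing the point obstruction `∑_{v∈S} inv_v(t_v ∪ₑ loc_v κ_{p^k}P)` on
every family of Kummer lifts, `E(K)/E_𝒦` is finite for `E_𝒦 = ker B.flip` (the points orthogonal to all local classes), and
**`#(A₀/Sel₀) · #(E(K)/E_𝒦) = ∏_{v∈S} #𝒦_{v,0}[p^∞]`** — Greenberg's Lemma 4.7 / Cassels–Poitou–Tate in positive rank with NO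
bookkeeping hypothesis left. In rank `0` this is the tree's `InputsGreenbergKerG.natCard_kerG_zero_eq_prod`.
[cite: GreenbergLNM1716, §4 p. 104, Lemma 4.7 (pp. 107–108), Prop. 4.13 (pp. 120–123)] [cite: MilneADT2006, Ch. I, Thm. 4.10, Lemma 6.15,
Thm. 6.13] [cite: Cassels1964ArithmeticVII, Thm.] -/
theorem exists_level_pointObstructionHom_natCard_kerG_zero_mul_eq_prod (hκ : κ.IsCyclotomic)
    (hE0 : Nat.card (MulAction.fixedPoints (absoluteGaloisGroup K) (W.geomPrimaryTorsion p)) = 1)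
    (S : Finset (HeightOneSpectrum (𝓞 K)))
    (hS : ∀ v ∉ S, ((p : ℕ) : 𝓞 K) ∉ v.asIdeal ∧ W.HasGoodReductionAt v)
    (hfin : ∀ v ∈ S, Finite (W.localTowerKerPrimary κ (v.adicCompletion K) 0))
    [Finite (AddCommGroup.primaryComponent (↥W.sha) p)] :
    ∃ k₀ : ℕ, ∀ k : ℕ, k₀ ≤ k →
      ∀ (ew : W.geomTorsion ((p ^ k : ℕ) : ℤ) → W.geomTorsion ((p ^ k : ℕ) : ℤ) → AlgebraicClosure K)
        (hμ : ∀ S T, ew S T ^ (p ^ k) = 1)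
        (hadd₁ : ∀ S₁ S₂ T, ew (S₁ + S₂) T = ew S₁ T * ew S₂ T)
        (hadd₂ : ∀ S T₁ T₂, ew S (T₁ + T₂) = ew S T₁ * ew S T₂)
        (hgal : ∀ (σ : absoluteGaloisGroup K) (S T : W.geomTorsion ((p ^ k : ℕ) : ℤ)), σ • ew S T = ew (σ • S) (σ • T)),
        (∀ T, ew T T = 1) → (∀ T, (∀ S, ew S T = 1) → T = 0) →
      ∀ (inv : LocalInvariants K (p ^ k)), inv.IsPerfect → inv.SumLocalTermEqZero → inv.SelmerComplement →
      ∃ B : (∀ v : S, W.localTowerKerPrimary κ (v.1.adicCompletion K) 0) →+ (W.toAffine.Point →+ ZMod (p ^ k)),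
        (∀ (x : ∀ v : S, W.localTowerKerPrimary κ (v.1.adicCompletion K) 0)
          (t : Π v : Place K, galoisCohomology ((W.torsionGaloisModule ((p ^ k : ℕ) : ℤ)).toLocal v) 1),
          (∀ v : S,
            resH1Hom (Literature.NumberTheory.EllipticCurves.subgroupIncl
                (localSubgroup (⊤ : Subgroup (absoluteGaloisGroup K)) (v.1.adicCompletion K)))
              (AddMonoidHom.id (localPoints W (v.1.adicCompletion K))) (fun _ _ ↦ rfl)
              (galoisCohomology.map (W.torsionPointsMapIntertwining ((p ^ k : ℕ) : ℤ) (v.1.adicCompletion K)) 1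
                (t (Sum.inr v.1))) =
            Literature.NumberTheory.EllipticCurves.resOfLe (localPoints W (v.1.adicCompletion K))
              (localSubgroup_top_le_layerSubgroup_zero κ (v.1.adicCompletion K))
              ((x v : W.localTowerKerPrimary κ (v.1.adicCompletion K) 0) :
                discreteH1 (localSubgroup (κ.layerSubgroup 0) (v.1.adicCompletion K))
                  (localPoints W (v.1.adicCompletion K)))) →
          ∀ P : W.toAffine.Point,
            B x P = ∑ u ∈ S, invWeilPairing W (p ^ k) ew hμ hadd₁ hadd₂ hgal inv (Sum.inr u) (t (Sum.inr u))
              (galoisCohomology.localization (W.torsionGaloisModule ((p ^ k : ℕ) : ℤ)) (Sum.inr u) 1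
                (kummerMapTorsion W ((p ^ k : ℕ) : ℤ)
                  (W.zsmul_geomPoints_surjective_holds (natCast_pow_ne_zero p k)) P))) ∧
        Finite (W.toAffine.Point ⧸ B.flip.ker) ∧
        Nat.card (W.KerG κ 0) * Nat.card (W.toAffine.Point ⧸ B.flip.ker) =
          ∏ v ∈ S, Nat.card (W.localTowerKerPrimary κ (v.adicCompletion K) 0) := by
  obtain ⟨e₁, he₁⟩ := exists_forall_pow_nsmul_eq_zero_of_finite_sha W p
  obtain ⟨n, hn⟩ := exists_forall_pow_nsmul_localTowerKerPrimary_eq_zero W p κ S hfin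
  refine ⟨n + 2 + e₁, fun k hk ew hμ hadd₁ hadd₂ hgal halt hnondeg inv hperf hvan hcompl ↦ ?_⟩
  obtain ⟨r, hr⟩ := Nat.exists_eq_add_of_le hk
  exact exists_pointObstructionHom_natCard_kerG_zero_mul_eq_prod_of_shaExponent W p κ k ew hμ hadd₁ hadd₂ hgal halt hnondeg
    hκ hE0 S hS hfin (n := n + r) (e₁ := e₁) (by omega)
    (fun v hv x hx ↦ by rw [pow_add, mul_comm, mul_smul, hn v hv x hx, smul_zero]) hperf hvan hcompl he₁

end Identity

end Summit.BirchSwinnertonDyer.BirchSwinnertonDyer.Theorems.AlignedTransportAtTwoEulerCharAtTwoKerGShaExponent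

end
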